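import Summits.QuantumFields.QCD.Theorems.HeatSlicedQuarksQuarkLoopCoefficientSecondOrderExpansionAuxD

/-!
# Second-order expansion of the heat symbol — part E: collapse of the second-order Duhamel integrand
(line `Sketch` of crux stmt-QuantumFields-16786, stub `stub_secondOrderExpansion`, helper file)

For `0 < s`, `0 ≤ r ≤ s`: the free convolution `freeConv (s − r)` of the second-order forcing
`F(r) = vtx 2 (pert0 r) + vtx 1 (pert1 r)` is an explicit finite combination `G(r, s, w)` of the constant
matrices `η'(v)`, `η(v)`, `1`, `η(v)η(u)`, polynomial in `r` (parts C, D), together with the summability of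
`y ↦ k_{s−r}(w − y) • F(r)(y)` needed later for the trace/series interchanges.
Notation (local): `η[v] = Σ_z (z∧v) • ď♯(z)ď(v−z)`, `η'[v] = Σ_z (z∧v)² • ď♯(z)ď(v−z)`.
-/

noncomputable section

namespace Summit.QuantumFields.QCD.Cruxes.QuarkLoopCoefficient.Sketch.SecondOrderExpansion

open Literature.MathematicalPhysics.QuantumLattice Literature.MathematicalPhysics.QuantumFieldTheory
open Literature.Probability.LatticeModels (Site)
open Summit.QuantumFields.QCD.Theorems.QuarkLoopCoefficient
open Summit.QuantumFields.QCD.Cruxes.QuarkLoopCoefficient.Sketch.HeatSeries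
open Summit.QuantumFields.QCD.Cruxes.QuarkLoopCoefficient.Sketch.FreeMajorantToolkit
open scoped Matrix ComplexConjugate

/-- The first-order matrix kernel `η(v) = Σ_{z ∈ nbr 0} (z∧v) • ď♯(z) ď(v−z)` (local notation). -/
local notation "η[" v "]" => (∑ z ∈ nbr 0, ((wedge z v : ℤ) : ℂ) • (dsharp z * dsymb (v - z)))

/-- The second-order matrix kernel `η'(v) = Σ_{z ∈ nbr 0} (z∧v)² • ď♯(z) ď(v−z)` (local notation). -/
local notation "η'[" v "]" => (∑ z ∈ nbr 0, (((wedge z v : ℤ) : ℂ) ^ 2) • (dsharp z * dsymb (v - z)))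

/-! ## §12 Linearity and summability of the free convolution on the groups -/

/-- Additivity of `freeConv` on summable fields. -/
theorem freeConv_add (t : ℝ) (f g : Site 4 → Spin) (w : Site 4)
    (hf : Summable (fun y : Site 4 => ((freeKer t (w - y) : ℝ) : ℂ) • f y))
    (hg : Summable (fun y : Site 4 => ((freeKer t (w - y) : ℝ) : ℂ) • g y)) :
    freeConv t (fun y => f y + g y) w = freeConv t f w + freeConv t g w := by
  unfold freeConv
  simp_rw [smul_add]
  exact hf.tsum_add hg

/-- Summability of `y ↦ k_t(w−y) • Σ_i c_i(y) • M_i` from the summability of the scalar coefficients. -/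
theorem summable_freeKer_smul_finset_sum_smul {ι : Type*} (S : Finset ι) (c : ι → Site 4 → ℂ)
    (M : ι → Spin) (t : ℝ) (w : Site 4)
    (hc : ∀ i ∈ S, Summable (fun y : Site 4 => ((freeKer t (w - y) : ℝ) : ℂ) * c i y)) :
    Summable (fun y : Site 4 => ((freeKer t (w - y) : ℝ) : ℂ) • ∑ i ∈ S, c i y • M i) := by
  refine (summable_sum fun i hi => (hc i hi).smul_const (M i)).congr fun y => ?_
  rw [Finset.smul_sum]
  refine Finset.sum_congr rfl fun i _ => ?_
  rw [smul_smul]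

/-- Group 1 summability. -/
theorem summable_group_one
    (h5 : ∀ s r : ℝ, 0 ≤ s → 0 ≤ r → ∀ w : Site 4,
      HasSum (fun y : Site 4 => freeKer s y * freeKer r (w - y)) (freeKer (s + r) w))
    {s r : ℝ} (hr : 0 ≤ r) (hrs : r ≤ s) (w : Site 4) :
    Summable (fun y : Site 4 => ((freeKer (s - r) (w - y) : ℝ) : ℂ) •
      ∑ v ∈ nbr2 0, (-1 / 8 * ((freeKer r (y - v) : ℝ) : ℂ)) • η'[v]) := by
  have hsr : 0 ≤ s - r := sub_nonneg.mpr hrs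
  refine summable_freeKer_smul_finset_sum_smul (nbr2 0) (fun v y => -1 / 8 * ((freeKer r (y - v) : ℝ) : ℂ))
    _ (s - r) w fun v _ => ?_
  exact ((summable_ofReal_mul_of_hasSum (s - r) w (hasSum_freeKer_mul_freeKer h5 hsr hr w v)).mul_left
    (-1 / 8)).congr fun y => by ring

/-- Group 2 summability. -/
theorem summable_group_two
    (h5 : ∀ s r : ℝ, 0 ≤ s → 0 ≤ r → ∀ w : Site 4,
      HasSum (fun y : Site 4 => freeKer s y * freeKer r (w - y)) (freeKer (s + r) w))
    (h6 : ∀ t : ℝ, 0 ≤ t → ∀ (w : Site 4) (ν : Fin 4),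
      t * (∑ z ∈ nbr2 0, ((z ν : ℤ) : ℝ) * hhat z * freeKer t (w - z)) + ((w ν : ℤ) : ℝ) * freeKer t w = 0)
    {s r : ℝ} (hs : 0 < s) (hr : 0 ≤ r) (hrs : r ≤ s) (w : Site 4) :
    Summable (fun y : Site 4 => ((freeKer (s - r) (w - y) : ℝ) : ℂ) •
      ∑ v ∈ nbr2 0, (-1 / 4 * ((wedge v y : ℤ) : ℂ) * ((freeKer r (y - v) : ℝ) : ℂ)) • η[v]) := by
  refine summable_freeKer_smul_finset_sum_smul (nbr2 0)
    (fun v y => -1 / 4 * ((wedge v y : ℤ) : ℂ) * ((freeKer r (y - v) : ℝ) : ℂ)) _ (s - r) w fun v _ => ?_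
  exact ((summable_ofReal_mul_of_hasSum (s - r) w (hasSum_group_two_coeff h5 h6 hs hr hrs w v)).mul_left
    (-1 / 4)).congr fun y => by push_cast; ring

/-- Group 3 summability. -/
theorem summable_group_three
    (h5 : ∀ s r : ℝ, 0 ≤ s → 0 ≤ r → ∀ w : Site 4,
      HasSum (fun y : Site 4 => freeKer s y * freeKer r (w - y)) (freeKer (s + r) w))
    (h6 : ∀ t : ℝ, 0 ≤ t → ∀ (w : Site 4) (ν : Fin 4),
      t * (∑ z ∈ nbr2 0, ((z ν : ℤ) : ℝ) * hhat z * freeKer t (w - z)) + ((w ν : ℤ) : ℝ) * freeKer t w = 0)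
    {s r : ℝ} (hs : 0 < s) (hr : 0 ≤ r) (hrs : r ≤ s) (w : Site 4) :
    Summable (fun y : Site 4 => ((freeKer (s - r) (w - y) : ℝ) : ℂ) •
      ((∑ v ∈ nbr2 0, -1 / 8 * ((wedge v y : ℤ) : ℂ) ^ 2 * ((hhat v : ℝ) : ℂ) *
        ((freeKer r (y - v) : ℝ) : ℂ)) • (1 : Spin))) := by
  have hreal : HasSum (fun y : Site 4 => freeKer (s - r) (w - y) * ∑ v ∈ nbr2 0,
      -1 / 8 * hhat v * (((wedge v y : ℤ) : ℝ) ^ 2 * freeKer r (y - v))) _ :=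
    (hasSum_sum fun v (_ : v ∈ nbr2 0) => (hasSum_group_three_coeff h5 h6 hs hr hrs w v).mul_left
      (-1 / 8 * hhat v)).congr_fun fun y => by
      rw [Finset.mul_sum]
      refine Finset.sum_congr rfl fun v _ => ?_
      ring
  have hsum : Summable (fun y : Site 4 => ((freeKer (s - r) (w - y) : ℝ) : ℂ) *
      ∑ v ∈ nbr2 0, -1 / 8 * ((wedge v y : ℤ) : ℂ) ^ 2 * ((hhat v : ℝ) : ℂ) * ((freeKer r (y - v) : ℝ) : ℂ)) := by
    refine (summable_ofReal_mul_of_hasSum (s - r) w hreal).congr fun y => ?_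
    push_cast
    congr 1
    refine Finset.sum_congr rfl fun v _ => ?_
    ring
  refine (hsum.smul_const (1 : Spin)).congr fun y => ?_
  rw [smul_smul]

/-- Groups 4/5 summability (double shift with a `y`-independent weight). -/
theorem summable_group_double
    (h5 : ∀ s r : ℝ, 0 ≤ s → 0 ≤ r → ∀ w : Site 4,
      HasSum (fun y : Site 4 => freeKer s y * freeKer r (w - y)) (freeKer (s + r) w))
    {s r : ℝ} (hr : 0 ≤ r) (hrs : r ≤ s) (w : Site 4) (c : Site 4 → Site 4 → ℂ) (M : Site 4 → Site 4 → Spin) :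
    Summable (fun y : Site 4 => ((freeKer (s - r) (w - y) : ℝ) : ℂ) •
      ∑ v ∈ nbr2 0, ∑ u ∈ nbr2 0, (c v u * ((freeKer r (y - v - u) : ℝ) : ℂ)) • M v u) := by
  have hsr : 0 ≤ s - r := sub_nonneg.mpr hrs
  have hS : ∀ v u : Site 4, HasSum (fun y : Site 4 => freeKer (s - r) (w - y) * freeKer r (y - v - u))
      (freeKer s (w - v - u)) := by
    intro v u
    have := hasSum_freeKer_mul_freeKer h5 hsr hr w (v + u)
    rw [sub_add_cancel, ← sub_sub] at this
    exact this.congr_fun fun y => by rw [sub_sub]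
  have e1 : (fun y : Site 4 => ((freeKer (s - r) (w - y) : ℝ) : ℂ) •
      ∑ v ∈ nbr2 0, ∑ u ∈ nbr2 0, (c v u * ((freeKer r (y - v - u) : ℝ) : ℂ)) • M v u) =
      fun y => ((freeKer (s - r) (w - y) : ℝ) : ℂ) •
        ∑ p ∈ nbr2 0 ×ˢ nbr2 0, (c p.1 p.2 * ((freeKer r (y - p.1 - p.2) : ℝ) : ℂ)) • M p.1 p.2 := by
    funext y; rw [Finset.sum_product]
  rw [e1]
  refine summable_freeKer_smul_finset_sum_smul (nbr2 0 ×ˢ nbr2 0)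
    (fun p y => c p.1 p.2 * ((freeKer r (y - p.1 - p.2) : ℝ) : ℂ)) (fun p => M p.1 p.2) (s - r) w fun p _ => ?_
  exact ((summable_ofReal_mul_of_hasSum (s - r) w (hS p.1 p.2)).mul_left (c p.1 p.2)).congr fun y => by ring

/-! ## §13 The full collapse of the second-order Duhamel integrand -/

/-- **Summability of the second-order Duhamel integrand**: `y ↦ k_{s−r}(w−y) • F(r)(y)` is summable
(`F(r) = vtx 2 (pert0 r) + vtx 1 (pert1 r)`, `0 < s`, `0 ≤ r ≤ s`). -/
theorem summable_freeKer_smul_forcing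
    (h1 : ∀ x y : Site 4, sqKer (fun _ => (1 : ℂ)) x y = ((hhat (y - x) : ℝ) : ℂ) • (1 : Spin))
    (h3 : ∀ w : Site 4, freeKer 0 w = if w = 0 then 1 else 0)
    (h5 : ∀ s r : ℝ, 0 ≤ s → 0 ≤ r → ∀ w : Site 4,
      HasSum (fun y : Site 4 => freeKer s y * freeKer r (w - y)) (freeKer (s + r) w))
    (h6 : ∀ t : ℝ, 0 ≤ t → ∀ (w : Site 4) (ν : Fin 4),
      t * (∑ z ∈ nbr2 0, ((z ν : ℤ) : ℝ) * hhat z * freeKer t (w - z)) + ((w ν : ℤ) : ℝ) * freeKer t w = 0)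
    {s r : ℝ} (hs : 0 < s) (hr : 0 ≤ r) (hrs : r ≤ s) (w : Site 4) :
    Summable (fun y : Site 4 => ((freeKer (s - r) (w - y) : ℝ) : ℂ) • (vtx 2 (pert0 r) y + vtx 1 (pert1 r) y)) := by
  have hA := summable_group_one h5 hr hrs w
  have hB := summable_group_two h5 h6 hs hr hrs w
  have hC := summable_group_three h5 h6 hs hr hrs w
  have hD := summable_group_double h5 hr hrs w (fun _ _ => (r : ℂ) / 4) (fun v u => η[v] * η[u])
  have hE := summable_group_double h5 hr hrs w
    (fun v u => (r : ℂ) / 4 * ((wedge v u : ℤ) : ℂ) * ((hhat v : ℝ) : ℂ)) (fun _ u => η[u])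
  refine (((hA.add hB).add hC).add (hD.add hE)).congr fun y => ?_
  rw [vtx_two_pert0_eq h1 r y, vtx_one_pert1_eq h1 h3 h5 h6 hr y]
  simp only [smul_add]

/-- **Collapse of the second-order Duhamel integrand**: for `0 < s`, `0 ≤ r ≤ s`,
`freeConv (s−r) (F r) w = G(r,s,w)` with the explicit finite combination `G` below. -/
theorem freeConv_forcing
    (h1 : ∀ x y : Site 4, sqKer (fun _ => (1 : ℂ)) x y = ((hhat (y - x) : ℝ) : ℂ) • (1 : Spin))
    (h3 : ∀ w : Site 4, freeKer 0 w = if w = 0 then 1 else 0)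
    (h5 : ∀ s r : ℝ, 0 ≤ s → 0 ≤ r → ∀ w : Site 4,
      HasSum (fun y : Site 4 => freeKer s y * freeKer r (w - y)) (freeKer (s + r) w))
    (h6 : ∀ t : ℝ, 0 ≤ t → ∀ (w : Site 4) (ν : Fin 4),
      t * (∑ z ∈ nbr2 0, ((z ν : ℤ) : ℝ) * hhat z * freeKer t (w - z)) + ((w ν : ℤ) : ℝ) * freeKer t w = 0)
    {s r : ℝ} (hs : 0 < s) (hr : 0 ≤ r) (hrs : r ≤ s) (w : Site 4) :
    freeConv (s - r) (fun y => vtx 2 (pert0 r) y + vtx 1 (pert1 r) y) w =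
      ∑ v ∈ nbr2 0, (-1 / 8 * ((freeKer s (w - v) : ℝ) : ℂ)) • η'[v] +
        ∑ v ∈ nbr2 0, (-1 / 4 * ((r : ℂ) / (s : ℂ)) * ((wedge v w : ℤ) : ℂ) * ((freeKer s (w - v) : ℝ) : ℂ)) • η[v] +
        (((∑ v ∈ nbr2 0, -1 / 8 * hhat v * ((r / s) ^ 2 * (((wedge v w : ℤ) : ℝ) ^ 2 * freeKer s (w - v)) -
          (s - r) * r / s *
            (((v 0 : ℤ) : ℝ) ^ 2 * ∑ z ∈ nbr2 0, ((z 1 : ℤ) : ℝ) * ((z 1 : ℤ) : ℝ) * hhat z * freeKer s (w - v - z) -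
              2 * ((v 0 : ℤ) : ℝ) * ((v 1 : ℤ) : ℝ) *
                ∑ z ∈ nbr2 0, ((z 0 : ℤ) : ℝ) * ((z 1 : ℤ) : ℝ) * hhat z * freeKer s (w - v - z) +
              ((v 1 : ℤ) : ℝ) ^ 2 * ∑ z ∈ nbr2 0, ((z 0 : ℤ) : ℝ) * ((z 0 : ℤ) : ℝ) * hhat z * freeKer s (w - v - z))) :
            ℝ)) : ℂ) • (1 : Spin) +
        (∑ v ∈ nbr2 0, ∑ u ∈ nbr2 0, ((r : ℂ) / 4 * ((freeKer s (w - v - u) : ℝ) : ℂ)) • (η[v] * η[u]) +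
          ∑ v ∈ nbr2 0, ∑ u ∈ nbr2 0,
            ((r : ℂ) / 4 * ((wedge v u : ℤ) : ℂ) * ((hhat v : ℝ) : ℂ) * ((freeKer s (w - v - u) : ℝ) : ℂ)) • η[u]) := by
  have hA := summable_group_one h5 hr hrs w
  have hB := summable_group_two h5 h6 hs hr hrs w
  have hC := summable_group_three h5 h6 hs hr hrs w
  have hD := summable_group_double h5 hr hrs w (fun _ _ => (r : ℂ) / 4) (fun v u => η[v] * η[u])
  have hE := summable_group_double h5 hr hrs w
    (fun v u => (r : ℂ) / 4 * ((wedge v u : ℤ) : ℂ) * ((hhat v : ℝ) : ℂ)) (fun _ u => η[u])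
  have hF : (fun y => vtx 2 (pert0 r) y + vtx 1 (pert1 r) y) = fun y =>
      ((∑ v ∈ nbr2 0, (-1 / 8 * ((freeKer r (y - v) : ℝ) : ℂ)) • η'[v] +
        ∑ v ∈ nbr2 0, (-1 / 4 * ((wedge v y : ℤ) : ℂ) * ((freeKer r (y - v) : ℝ) : ℂ)) • η[v]) +
        (∑ v ∈ nbr2 0, -1 / 8 * ((wedge v y : ℤ) : ℂ) ^ 2 * ((hhat v : ℝ) : ℂ) *
          ((freeKer r (y - v) : ℝ) : ℂ)) • (1 : Spin)) +
      (∑ v ∈ nbr2 0, ∑ u ∈ nbr2 0, ((r : ℂ) / 4 * ((freeKer r (y - v - u) : ℝ) : ℂ)) • (η[v] * η[u]) +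
        ∑ v ∈ nbr2 0, ∑ u ∈ nbr2 0,
          ((r : ℂ) / 4 * ((wedge v u : ℤ) : ℂ) * ((hhat v : ℝ) : ℂ) * ((freeKer r (y - v - u) : ℝ) : ℂ)) • η[u]) := by
    funext y
    rw [vtx_two_pert0_eq h1 r y, vtx_one_pert1_eq h1 h3 h5 h6 hr y]
  have hAB : Summable (fun y : Site 4 => ((freeKer (s - r) (w - y) : ℝ) : ℂ) •
      (∑ v ∈ nbr2 0, (-1 / 8 * ((freeKer r (y - v) : ℝ) : ℂ)) • η'[v] +
        ∑ v ∈ nbr2 0, (-1 / 4 * ((wedge v y : ℤ) : ℂ) * ((freeKer r (y - v) : ℝ) : ℂ)) • η[v])) :=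
    (hA.add hB).congr fun y => by simp only [smul_add]
  have hABC : Summable (fun y : Site 4 => ((freeKer (s - r) (w - y) : ℝ) : ℂ) •
      ((∑ v ∈ nbr2 0, (-1 / 8 * ((freeKer r (y - v) : ℝ) : ℂ)) • η'[v] +
        ∑ v ∈ nbr2 0, (-1 / 4 * ((wedge v y : ℤ) : ℂ) * ((freeKer r (y - v) : ℝ) : ℂ)) • η[v]) +
        (∑ v ∈ nbr2 0, -1 / 8 * ((wedge v y : ℤ) : ℂ) ^ 2 * ((hhat v : ℝ) : ℂ) *
          ((freeKer r (y - v) : ℝ) : ℂ)) • (1 : Spin))) :=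
    (hAB.add hC).congr fun y => by simp only [smul_add]
  have hDE : Summable (fun y : Site 4 => ((freeKer (s - r) (w - y) : ℝ) : ℂ) •
      (∑ v ∈ nbr2 0, ∑ u ∈ nbr2 0, ((r : ℂ) / 4 * ((freeKer r (y - v - u) : ℝ) : ℂ)) • (η[v] * η[u]) +
        ∑ v ∈ nbr2 0, ∑ u ∈ nbr2 0,
          ((r : ℂ) / 4 * ((wedge v u : ℤ) : ℂ) * ((hhat v : ℝ) : ℂ) * ((freeKer r (y - v - u) : ℝ) : ℂ)) • η[u])) :=
    (hD.add hE).congr fun y => by simp only [smul_add]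
  rw [hF, freeConv_add _ _ _ _ hABC hDE, freeConv_add _ _ _ _ hAB hC, freeConv_add _ _ _ _ hA hB,
    freeConv_add _ _ _ _ hD hE,
    freeConv_group_one h5 hr hrs w, freeConv_group_two h5 h6 hs hr hrs w, freeConv_group_three h5 h6 hs hr hrs w]
  congr 2
  · exact freeConv_group_double h5 hr hrs w (fun _ _ => (r : ℂ) / 4) (fun v u => η[v] * η[u])
  · exact freeConv_group_double h5 hr hrs w
      (fun v u => (r : ℂ) / 4 * ((wedge v u : ℤ) : ℂ) * ((hhat v : ℝ) : ℂ)) (fun _ u => η[u])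

/-! ## Registered headline -/

/-- Registered headline of this helper file (aux stub `stub_secondOrderExpansionAuxE` of crux
stmt-QuantumFields-16786, line `Sketch`): additivity of the free convolution on summable fields. -/
theorem stub_secondOrderExpansionAuxE : ∀ (t : ℝ) (f g : Site 4 → Spin) (w : Site 4), Summable (fun y : Site 4 => ((freeKer t (w - y) : ℝ) : ℂ) • f y) → Summable (fun y : Site 4 => ((freeKer t (w - y) : ℝ) : ℂ) • g y) → freeConv t (fun y => f y + g y) w = freeConv t f w + freeConv t g w :=
  fun t f g w hf hg => freeConv_add t f g w hf hg

end Summit.QuantumFields.QCD.Cruxes.QuarkLoopCoefficient.Sketch.SecondOrderExpansion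

end
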